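/-
COR-CM (cell pub-hodgecm2 = stage 2 of the Hodge ladder), seat b26 gen 16 (prover-pub-hodgecm2-b26-g16-0, 2026-08-21);
count-neutral for the binder table (no row).  The abelian-variety reading of
`Geometry/WeightOneHodgeStructureOfPeriodIsogeny`: the elliptic curves of two periods are isogenous iff the periods
lie in one `GL₂(ℚ)`-orbit.  Theorems only: no definition, no named fact, no instance.
-/
import Summits.HodgeConjecture.CorCM.Assembly.CMEllipticCurveOfPeriod
import Summits.HodgeConjecture.CorCM.Geometry.WeightOneHodgeStructureOfPeriodIsogeny
import HarnessLib

/-!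
# The elliptic curves of two periods are isogenous iff `τ' ∈ GL₂(ℚ) · τ`

For complex abelian varieties `E`, `E'` with `H¹_B(E) ≅ V¹_τ` and `H¹_B(E') ≅ V¹_τ'` in `Hod_ℚ` (`τ, τ' ∉ ℝ`; they are
elliptic curves and exist for `Im τ, Im τ' > 0`, `PeriodCurve.exists_ellipticCurve`):

* **`isIsogenous_iff`** — `E` and `E'` are ISOGENOUS iff `τ' (a + bτ) = c + dτ` for some rationals with `a + bτ ≠ 0`,
  i.e. `τ' = (c + dτ)/(a + bτ) ∈ GL₂(ℚ) · τ` — the classical description of the isogeny classes of complex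
  elliptic curves by their periods (Silverman AEC VI §4–5), proved through Hodge theory: Moonen–Zarhin Lemma (3.3)
  `Hom(E, E') ⊗ ℚ = Hom_HS(H¹E', H¹E)`, i.e. RIEMANN'S THEOREM — fullness `deligneMilne1982_Thm_6_20_full_holds`
  (tree theorem) — and faithfulness, plus `PeriodHodgeStructure.exists_hom_bijective_iff`;
* dimension-free lemmas (§1): a morphism `H¹_B(A') → H¹_B(A)` of the weight-one Hodge structures of two complex
  abelian varieties is a morphism in the sense of the fullness record (`isHodgeMorphismOne_of_hom₂`); **a bijective
  one lifts to an ISOGENY `A → A'`** (`exists_isIsogeny_of_hom_bijective`: `u^* = k T` injective on `H¹(A'(ℂ); ℂ)`,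
  so `u` is onto, `surjective_of_injective_complexBetti_map_one`, between varieties of equal dimension); conversely
  an isogeny `u` induces the bijective morphism `u^* : H¹_B(A') ≅ H¹_B(A)` (`exists_hom_bijective_of_isIsogeny`,
  quasi-inverse `g`, `u g = g u = n`);
* instances: `E ~ E'` for `τ' = τ + r`, `r τ`, `-1/τ` (`isIsogenous_of_add_ratCast`, `…_ratCast_mul`, `…_neg_inv`).

HONEST SCOPE: classification of the curves `E` with `H¹_B(E) ≅ V¹_τ` up to isogeny; nothing here bears on HC_CM.

References: [MoonenZarhin1999LowDim] Math. Ann. 315 (1999), §3 Lemma (3.3), Cor. (3.9) ·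
[DeligneMilne1982Tannakian] LNM 900, II Thm. 6.20 (Riemann), p. 212 · [SilvermanAEC2009] VI §4 Thm. 4.1, §5 ·
[LangeBirkenhake1992] §1.2 Prop. 1.2.3 · [MumfordAV1970] §19 Remark p. 169.
-/

noncomputable section

open scoped TensorProduct
open CategoryTheory Module
open Literature.AlgebraicGeometry.Motives Literature.AlgebraicGeometry.HodgeTheory
open Literature.AlgebraicGeometry.ComplexMultiplication
open Literature.AlgebraicGeometry.Motives.HodgeStructure

namespace Summit.HodgeConjecture.CorCM.PeriodCurve

/-! ## §1 Morphisms `H¹_B(A') → H¹_B(A)` and isogenies `A → A'` -/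

section TwoAbelianVarieties

variable {A A' : AbelianVariety ℂ} {B : HodgeModel A.dim A.X} {hB : B.IsHodgeSymmetric}
  {B' : HodgeModel A'.dim A'.X} {hB' : B'.IsHodgeSymmetric}

/-- A morphism `H¹_B(A') → H¹_B(A)` of the weight-one Hodge structures (read in any Hodge-symmetric models) is a
morphism of rational Hodge structures of weight one in the sense of the fullness record (`IsHodgeMorphismOne A A'`):
model independence (`bettiOneHodgeStructure_eq_cast_hodge`) and `isHodgeMorphismOne_of_map_F_le`.
[cite: VoisinHodgeI2002, §7.1.1 Def. 7.4 and §7.3.2] [cite: DeligneMilne1982Tannakian, §6 (Hod_ℚ)] -/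
theorem isHodgeMorphismOne_of_hom₂ (T : Hom (bettiOneHodgeStructure A' B' hB') (bettiOneHodgeStructure A B hB)) :
    IsHodgeMorphismOne A A' T.toLinearMap := by
  have e := bettiOneHodgeStructure_eq_cast_hodge exists_isReal_hodgeModel_holds
    hodgePQ_independent_of_hodgeModel_holds A B hB AbelianVariety.isSmoothProjective_holds
  have e' := bettiOneHodgeStructure_eq_cast_hodge exists_isReal_hodgeModel_holds
    hodgePQ_independent_of_hodgeModel_holds A' B' hB' AbelianVariety.isSmoothProjective_holds
  refine isHodgeMorphismOne_of_map_F_le exists_isReal_hodgeModel_holds hodgePQ_independent_of_hodgeModel_holds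
    T.toLinearMap fun p => ?_
  have key : ∀ ψ : bettiCohomology A'.X 1 →ₗ[ℚ] bettiCohomology A.X 1,
      ((bettiOneHodgeStructure A' B' hB').F p).map (ψ.baseChange ℂ) ≤ (bettiOneHodgeStructure A B hB).F p →
        (((BettiUniverse.hodge exists_isReal_hodgeModel_holds (AbelianVariety.isSmoothProjective_holds (A := A'))
            1).cast Nat.cast_one).F p).map (ψ.baseChange ℂ) ≤
          ((BettiUniverse.hodge exists_isReal_hodgeModel_holds (AbelianVariety.isSmoothProjective_holds (A := A))
            1).cast Nat.cast_one).F p :=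
    fun ψ hψ => e ▸ e' ▸ hψ
  have h := key T.toLinearMap (T.map_F_le p)
  rwa [cast_F, cast_F] at h

/-- **Riemann's theorem (fullness), applied to two abelian varieties**: every morphism `T : H¹_B(A') → H¹_B(A)` is
`k⁻¹ u^*` for a homomorphism `u : A → A'` and some `k ≥ 1` (the tree's theorem `deligneMilne1982_Thm_6_20_full_holds`).
[cite: DeligneMilne1982Tannakian, art. II §6 Thm. 6.20 (Riemann), LNM 900 p. 212] -/
theorem exists_map_eq_smul₂ (T : Hom (bettiOneHodgeStructure A' B' hB') (bettiOneHodgeStructure A B hB)) :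
    ∃ (u : A ⟶ A') (k : ℕ), 0 < k ∧ (bettiCohomology.map u.hom.hom.hom 1).hom = (k : ℚ) • T.toLinearMap := by
  obtain ⟨u, k, hk, hu⟩ := deligneMilne1982_Thm_6_20_full_holds A A' T.toLinearMap
    (nonempty_hodgeModel_holds AbelianVariety.isSmoothProjective_holds) (isHodgeMorphismOne_of_hom₂ T)
  exact ⟨u, k, hk, LinearMap.ext fun v => by rw [LinearMap.smul_apply, Nat.cast_smul_eq_nsmul]; exact hu v⟩

/-- Base change to `ℂ` of an injective `ℚ`-linear map is injective (`ℂ` is flat over `ℚ`). [folklore] -/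
theorem baseChange_injective {V W : Type*} [AddCommGroup V] [Module ℚ V] [AddCommGroup W] [Module ℚ W]
    {g : V →ₗ[ℚ] W} (hg : Function.Injective g) : Function.Injective (g.baseChange ℂ) := by
  rw [LinearMap.baseChange_eq_ltensor]
  exact Module.Flat.lTensor_preserves_injective_linearMap g hg

/-- **An isomorphism `H¹_B(A') ≅ H¹_B(A)` in `Hod_ℚ` lifts to an isogeny `A → A'`**: with `u^* = k T` (fullness),
`u^*` is injective on `H¹(A'(ℂ); ℚ)`, hence on `H¹(A'(ℂ); ℂ) = ℂ ⊗ H¹(A'(ℂ); ℚ)`, so `u` is onto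
(`surjective_of_injective_complexBetti_map_one`); and `dim A = dim A'` (`2 dim = dim_ℚ H¹`), so `u` is an isogeny
(`isIsogeny_of_surjective_of_dim_eq`).  (Moonen–Zarhin Lemma (3.3): «… and `Y` is isogenous to `X`».)
[cite: MoonenZarhin1999LowDim, §3 Lemma (3.3)] [cite: DeligneMilne1982Tannakian, art. II §6 Thm. 6.20 (Riemann), LNM 900 p. 212] -/
theorem exists_isIsogeny_of_hom_bijective
    (T : Hom (bettiOneHodgeStructure A' B' hB') (bettiOneHodgeStructure A B hB)) (hT : Function.Bijective T.toLinearMap) :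
    ∃ u : A ⟶ A', AbelianVariety.IsIsogeny u := by
  have hX : IsSmoothProjective A.dim A.X := AbelianVariety.isSmoothProjective_holds
  have hX' : IsSmoothProjective A'.dim A'.X := AbelianVariety.isSmoothProjective_holds
  obtain ⟨u, k, hk, hu⟩ := exists_map_eq_smul₂ T
  have hk0 : (k : ℚ) ≠ 0 := Nat.cast_ne_zero.2 hk.ne'
  have hinjQ : Function.Injective (bettiCohomology.map u.hom.hom.hom 1).hom := by
    rw [hu]
    intro v w hvw
    exact hT.1 (smul_right_injective _ hk0 hvw)
  have hinj : Function.Injective (complexBetti.map u.hom.hom.hom 1) := by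
    intro y y' hyy'
    obtain ⟨t, rfl⟩ := (ofRatClassBaseChangeEquiv hX' 1).surjective y
    obtain ⟨t', rfl⟩ := (ofRatClassBaseChangeEquiv hX' 1).surjective y'
    rw [complexBetti_map_ofRatClassBaseChangeEquiv hX hX', complexBetti_map_ofRatClassBaseChangeEquiv hX hX']
      at hyy'
    rw [baseChange_injective hinjQ ((ofRatClassBaseChangeEquiv hX 1).injective hyy')]
  haveI := AbelianVariety.surjective_of_injective_complexBetti_map_one u hinj
  refine ⟨u, AbelianVariety.isIsogeny_of_surjective_of_dim_eq u ?_⟩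
  have h := (LinearEquiv.ofBijective T.toLinearMap hT).finrank_eq
  rw [finrank_bettiCohomology_one, finrank_bettiCohomology_one] at h
  omega

/-- **An isogeny `u : A → A'` induces an isomorphism `u^* : H¹_B(A') ≅ H¹_B(A)` in `Hod_ℚ`**: `u^*` preserves the
Hodge filtrations (`BettiUniverse.pull_hodge`), and is bijective on `H¹(−; ℚ)` because of a quasi-inverse `g`
with `u g = n`, `g u = n`, `n ≥ 1` (`IsIsogeny.exists_nsmul_inverse_holds`). [cite: MumfordAV1970, §19 Remark p. 169]
[cite: VoisinHodgeI2002, §7.3.2] [cite: MoonenZarhin1999LowDim, §3 Lemma (3.3) and Cor. (3.9)] -/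
theorem exists_hom_bijective_of_isIsogeny {u : A ⟶ A'} (hu : AbelianVariety.IsIsogeny u) :
    ∃ T : Hom (bettiOneHodgeStructure A' B' hB') (bettiOneHodgeStructure A B hB),
      Function.Bijective T.toLinearMap ∧ T.toLinearMap = (bettiCohomology.map u.hom.hom.hom 1).hom := by
  have hX : IsSmoothProjective A.dim A.X := AbelianVariety.isSmoothProjective_holds
  have hX' : IsSmoothProjective A'.dim A'.X := AbelianVariety.isSmoothProjective_holds
  have e := bettiOneHodgeStructure_eq_cast_hodge exists_isReal_hodgeModel_holds
    hodgePQ_independent_of_hodgeModel_holds A B hB hX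
  have e' := bettiOneHodgeStructure_eq_cast_hodge exists_isReal_hodgeModel_holds
    hodgePQ_independent_of_hodgeModel_holds A' B' hB' hX'
  have hF := BettiUniverse.pull_hodge exists_isReal_hodgeModel_holds hodgePQ_independent_of_hodgeModel_holds
    hX hX' u.hom.hom.hom 1
  refine ⟨⟨BettiUniverse.pull u.hom.hom.hom 1, fun p => by rw [e, e', cast_F, cast_F]; exact hF p⟩, ?_, rfl⟩
  obtain ⟨g, n, hn, hug, hgu⟩ := AbelianVariety.IsIsogeny.exists_nsmul_inverse_holds hu
  have h1 : (bettiCohomology.map u.hom.hom.hom 1).hom ∘ₗ (bettiCohomology.map g.hom.hom.hom 1).hom =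
      n • LinearMap.id := by
    rw [← ModuleCat.hom_comp, ← bettiCohomology_map_comp_hom, hug, bettiCohomology_map_nsmul_id_one,
      ModuleCat.hom_nsmul, ModuleCat.hom_id]
  have h2 : (bettiCohomology.map g.hom.hom.hom 1).hom ∘ₗ (bettiCohomology.map u.hom.hom.hom 1).hom =
      n • LinearMap.id := by
    rw [← ModuleCat.hom_comp, ← bettiCohomology_map_comp_hom, hgu, bettiCohomology_map_nsmul_id_one,
      ModuleCat.hom_nsmul, ModuleCat.hom_id]
  exact ⟨injective_of_comp_eq_nsmul_id hn h2, surjective_of_comp_eq_nsmul_id hn h1⟩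

/-- **Moonen–Zarhin Lemma (3.3) at the level of `Hod_ℚ`-isomorphisms**: `A` and `A'` are isogenous iff
`H¹_B(A') ≅ H¹_B(A)` by a morphism of Hodge structures (no dimension hypothesis).
[cite: MoonenZarhin1999LowDim, §3 Lemma (3.3) and Cor. (3.9)] [cite: DeligneMilne1982Tannakian, art. II §6 Thm. 6.20 (Riemann), LNM 900 p. 212] -/
theorem isIsogenous_iff_exists_hom_bijective :
    A.IsIsogenous A' ↔ ∃ T : Hom (bettiOneHodgeStructure A' B' hB') (bettiOneHodgeStructure A B hB),
      Function.Bijective T.toLinearMap :=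
  ⟨fun ⟨_, hu⟩ => let ⟨T, hT, _⟩ := exists_hom_bijective_of_isIsogeny (hB := hB) (hB' := hB') hu; ⟨T, hT⟩,
    fun ⟨T, hT⟩ => exists_isIsogeny_of_hom_bijective T hT⟩

end TwoAbelianVarieties

/-! ## §2 Elliptic curves with period structures: isogenous iff the periods are `GL₂(ℚ)`-equivalent -/

section TwoPeriods

variable {τ τ' : ℂ} {ω ω' : ℂ ⊗[ℚ] (Fin 2 → ℚ)}
  (h0 : TensorProduct.piScalarRight ℚ ℂ ℂ (Fin 2) ω 0 = 1) (h1 : TensorProduct.piScalarRight ℚ ℂ ℂ (Fin 2) ω 1 = τ)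
  (h0' : TensorProduct.piScalarRight ℚ ℂ ℂ (Fin 2) ω' 0 = 1)
  (h1' : TensorProduct.piScalarRight ℚ ℂ ℂ (Fin 2) ω' 1 = τ')
  (hP : IsCompl (ℂ ∙ ω) (complexConj (ℂ ∙ ω))) (hP' : IsCompl (ℂ ∙ ω') (complexConj (ℂ ∙ ω')))
  {E E' : AbelianVariety ℂ} {B : HodgeModel E.dim E.X} {hB : B.IsHodgeSymmetric}
  {B' : HodgeModel E'.dim E'.X} {hB' : B'.IsHodgeSymmetric}
  (f : Hom (bettiOneHodgeStructure E B hB) (ofSplitting (ℂ ∙ ω) hP one_pos : HodgeStructure (Fin 2 → ℚ) 1))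
  (hf : Function.Bijective f.toLinearMap)
  (f' : Hom (bettiOneHodgeStructure E' B' hB') (ofSplitting (ℂ ∙ ω') hP' one_pos : HodgeStructure (Fin 2 → ℚ) 1))
  (hf' : Function.Bijective f'.toLinearMap)

include f hf f' hf' in
/-- Isogeny classes match isomorphism classes of the period structures: `E ~ E'` iff `V¹_τ' ≅ V¹_τ` in `Hod_ℚ`
(transport along `f`, `f'`). [cite: MoonenZarhin1999LowDim, §3 Lemma (3.3) and Cor. (3.9)] -/
theorem isIsogenous_iff_exists_periodHom_bijective :
    E.IsIsogenous E' ↔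
      ∃ S : Hom (ofSplitting (ℂ ∙ ω') hP' one_pos : HodgeStructure (Fin 2 → ℚ) 1) (ofSplitting (ℂ ∙ ω) hP one_pos),
        Function.Bijective S.toLinearMap := by
  rw [isIsogenous_iff_exists_hom_bijective (hB := hB) (hB' := hB')]
  constructor
  · rintro ⟨T, hT⟩
    exact ⟨f.comp (T.comp (f'.symmOfBijective hf')), hf.comp (hT.comp (f'.symmOfBijective_bijective hf'))⟩
  · rintro ⟨S, hS⟩
    exact ⟨(f.symmOfBijective hf).comp (S.comp f'), (f.symmOfBijective_bijective hf).comp (hS.comp hf')⟩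

include h0 h1 h0' h1' f hf f' hf' in
/-- **ISOGENY CLASSES OF ELLIPTIC CURVES BY PERIODS.**  For complex abelian varieties `E`, `E'` with
`H¹_B(E) ≅ V¹_τ`, `H¹_B(E') ≅ V¹_τ'` (`τ ∉ ℝ`): **`E` and `E'` are isogenous iff `τ' (a + bτ) = c + dτ` for some
rationals `a, b, c, d` with `a + bτ ≠ 0`**, i.e. `τ' = (c + dτ)/(a + bτ) ∈ GL₂(ℚ) · τ` — the classical description of
the isogeny class of `ℂ/(ℤ + τℤ)`, through Riemann's theorem (`isIsogenous_iff_exists_hom_bijective`) and the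
classification of morphisms `V¹_τ → V¹_τ'` (`PeriodHodgeStructure.exists_hom_bijective_iff`, `…_comm`).
[cite: MoonenZarhin1999LowDim, §3 Lemma (3.3) and Cor. (3.9)] [cite: SilvermanAEC2009, VI §4 Thm. 4.1 and §5]
[cite: DeligneMilne1982Tannakian, art. II §6 Thm. 6.20 (Riemann), LNM 900 p. 212] -/
theorem isIsogenous_iff (hτ : τ.im ≠ 0) :
    E.IsIsogenous E' ↔ ∃ a b c d : ℚ, (a : ℂ) + b * τ ≠ 0 ∧ τ' * (a + b * τ) = c + d * τ := by
  rw [isIsogenous_iff_exists_periodHom_bijective hP hP' f hf f' hf',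
    ← PeriodHodgeStructure.exists_hom_bijective_iff h0 h1 h0' h1' hP hP' hτ]
  constructor
  · rintro ⟨S, hS⟩
    exact ⟨S.symmOfBijective hS, S.symmOfBijective_bijective hS⟩
  · rintro ⟨S, hS⟩
    exact ⟨S.symmOfBijective hS, S.symmOfBijective_bijective hS⟩

include h0 h1 h0' h1' f hf f' hf' in
/-- `E ~ E'` when `τ' = τ + r`, `r ∈ ℚ`. [cite: SilvermanAEC2009, VI §4 Thm. 4.1 and §5] -/
theorem isIsogenous_of_add_ratCast (hτ : τ.im ≠ 0) (r : ℚ) (h : τ' = τ + r) : E.IsIsogenous E' :=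
  (isIsogenous_iff h0 h1 h0' h1' hP hP' f hf f' hf' hτ).2 ⟨1, 0, r, 1, by simp, by rw [h]; push_cast; ring⟩

include h0 h1 h0' h1' f hf f' hf' in
/-- `E ~ E'` when `τ' = r τ`, `r ∈ ℚ` (e.g. `ℂ/(ℤ + τℤ) → ℂ/(ℤ + rτℤ)`). [cite: SilvermanAEC2009, VI §4 Thm. 4.1 and §5] -/
theorem isIsogenous_of_ratCast_mul (hτ : τ.im ≠ 0) (r : ℚ) (h : τ' = r * τ) : E.IsIsogenous E' :=
  (isIsogenous_iff h0 h1 h0' h1' hP hP' f hf f' hf' hτ).2 ⟨1, 0, 0, r, by simp, by rw [h]; push_cast; ring⟩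

include h0 h1 h0' h1' f hf f' hf' in
/-- `E ~ E'` when `τ' = -1/τ` (with the two previous ones: invariance of the isogeny class under `GL₂(ℚ)` acting by
Möbius transformations on the period). [cite: SilvermanAEC2009, VI §4 Thm. 4.1 and §5] -/
theorem isIsogenous_of_neg_inv (hτ : τ.im ≠ 0) (h : τ' = -τ⁻¹) : E.IsIsogenous E' := by
  obtain ⟨S, hS⟩ := PeriodHodgeStructure.exists_hom_bijective_neg_inv h0 h1 h0' h1' hP hP' hτ h
  exact (isIsogenous_iff_exists_periodHom_bijective hP hP' f hf f' hf').2
    ⟨S.symmOfBijective hS, S.symmOfBijective_bijective hS⟩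

include h0 h1 h0' h1' f hf f' hf' in
/-- **CM case: isogenous iff the periods span the same imaginary quadratic field.**  If `τ² + pτ + q = 0`
(`p, q ∈ ℚ`, `τ ∉ ℝ`), then `E ~ E'` iff **`τ' = c + dτ` for some rationals `c, d`**, i.e. `τ' ∈ ℚ(τ) = ℚ ⊕ ℚτ`
(`GL₂(ℚ) · τ = ℚ(τ) ∖ ℚ`: `(a + bτ)⁻¹ = ((a − bp) − bτ)/N`, `N = a² − abp + b²q ≠ 0`).  So two CM elliptic curves are
isogenous iff their periods generate the same imaginary quadratic field. [cite: SilvermanAEC2009, VI §4 Thm. 4.1 and §5]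
[cite: MoonenZarhin1999LowDim, §3 Lemma (3.3) and Cor. (3.9)] -/
theorem isIsogenous_iff_of_quadratic (hτ : τ.im ≠ 0) {p q : ℚ} (hτ2 : τ ^ 2 + p * τ + q = 0) :
    E.IsIsogenous E' ↔ ∃ c d : ℚ, τ' = c + d * τ := by
  rw [isIsogenous_iff h0 h1 h0' h1' hP hP' f hf f' hf' hτ]
  constructor
  · rintro ⟨a, b, c, d, hab, hrel⟩
    -- `N = a² - abp + b²q ≠ 0`, since `(a + bτ)((a - bp) - bτ) = N`
    have hN : ((a ^ 2 - a * b * p + b ^ 2 * q : ℚ) : ℂ) ≠ 0 := by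
      intro hN
      have hprod : ((a : ℂ) + b * τ) * (((a - b * p : ℚ) : ℂ) + ((-b : ℚ) : ℂ) * τ) = 0 := by
        push_cast at hN ⊢
        linear_combination hN - (b : ℂ) ^ 2 * hτ2
      rcases mul_eq_zero.1 hprod with h | h
      · exact hab h
      · obtain ⟨h1, h2⟩ := PeriodHodgeStructure.rat_eq_zero_of_add_mul_eq_zero hτ h
        have hb : b = 0 := by linarith
        have ha : a = 0 := by rw [hb, zero_mul, sub_zero] at h1; exact h1
        apply hab
        rw [ha, hb]
        push_cast
        ring
    refine ⟨(a * c - b * c * p + b * d * q) / (a ^ 2 - a * b * p + b ^ 2 * q),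
      (a * d - b * c) / (a ^ 2 - a * b * p + b ^ 2 * q), ?_⟩
    push_cast at hN ⊢
    rw [div_mul_eq_mul_div, ← add_div, eq_div_iff hN]
    linear_combination ((a : ℂ) - b * p - b * τ) * hrel + (τ' * (b : ℂ) ^ 2 - d * b) * hτ2
  · rintro ⟨c, d, h⟩
    exact ⟨1, 0, c, d, by simp, by rw [h]; push_cast; ring⟩

end TwoPeriods

/-! ## §3 Export at the level of `τ`, `τ'` -/

/-- **Isogeny classes of complex elliptic curves by periods, quantifier form.**  For `Im τ, Im τ' > 0` there are
weight-one Hodge structures `H = V¹_τ`, `H' = V¹_τ'` on `ℚ²` (`F¹ = ℂ (1, τ)`, resp. `ℂ (1, τ')`), elliptic curves with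
`H¹_B ≅ H`, resp. `≅ H'`, exist, and ANY two complex abelian varieties `E`, `E'` with `H¹_B(E) ≅ H`, `H¹_B(E') ≅ H'`
are isogenous iff `τ' (a + bτ) = c + dτ` for some rationals with `a + bτ ≠ 0`.
[cite: MoonenZarhin1999LowDim, §3 Lemma (3.3) and Cor. (3.9)] [cite: SilvermanAEC2009, VI §4 Thm. 4.1 and §5]
[cite: DeligneMilne1982Tannakian, art. II §6 Thm. 6.20 (Riemann), LNM 900 p. 212] -/
theorem isIsogenous_iff_of_periods {τ τ' : ℂ} (hτ : 0 < τ.im) (hτ' : 0 < τ'.im) :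
    ∃ H H' : HodgeStructure (Fin 2 → ℚ) 1,
      H.F 1 = ℂ ∙ ((1 : ℂ) ⊗ₜ[ℚ] (Pi.single 0 1 : Fin 2 → ℚ) + τ ⊗ₜ[ℚ] Pi.single 1 1) ∧
      H'.F 1 = ℂ ∙ ((1 : ℂ) ⊗ₜ[ℚ] (Pi.single 0 1 : Fin 2 → ℚ) + τ' ⊗ₜ[ℚ] Pi.single 1 1) ∧
      (∃ (E : AbelianVariety ℂ) (B : HodgeModel E.dim E.X) (hB : B.IsHodgeSymmetric)
        (f : Hom (bettiOneHodgeStructure E B hB) H), Function.Bijective f.toLinearMap) ∧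
      (∃ (E' : AbelianVariety ℂ) (B' : HodgeModel E'.dim E'.X) (hB' : B'.IsHodgeSymmetric)
        (f' : Hom (bettiOneHodgeStructure E' B' hB') H'), Function.Bijective f'.toLinearMap) ∧
      ∀ (E E' : AbelianVariety ℂ) (B : HodgeModel E.dim E.X) (hB : B.IsHodgeSymmetric)
        (B' : HodgeModel E'.dim E'.X) (hB' : B'.IsHodgeSymmetric)
        (f : Hom (bettiOneHodgeStructure E B hB) H) (f' : Hom (bettiOneHodgeStructure E' B' hB') H'),
        Function.Bijective f.toLinearMap → Function.Bijective f'.toLinearMap →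
          (E.IsIsogenous E' ↔ ∃ a b c d : ℚ, (a : ℂ) + b * τ ≠ 0 ∧ τ' * (a + b * τ) = c + d * τ) := by
  obtain ⟨h0, h1⟩ := coords_periodVector τ
  obtain ⟨h0', h1'⟩ := coords_periodVector τ'
  have hP := PeriodHodgeStructure.isCompl_span h0 h1 hτ.ne'
  have hP' := PeriodHodgeStructure.isCompl_span h0' h1' hτ'.ne'
  obtain ⟨E, B, hB, f, hf, -⟩ := exists_ellipticCurve h0 h1 hP hτ
  obtain ⟨E', B', hB', f', hf', -⟩ := exists_ellipticCurve h0' h1' hP' hτ'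
  exact ⟨_, _, PeriodHodgeStructure.F_one hP, PeriodHodgeStructure.F_one hP', ⟨E, B, hB, f, hf⟩,
    ⟨E', B', hB', f', hf'⟩, fun E E' B hB B' hB' g g' hg hg' =>
      isIsogenous_iff h0 h1 h0' h1' hP hP' g hg g' hg' hτ.ne'⟩

end Summit.HodgeConjecture.CorCM.PeriodCurve

end
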